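import Literature.AlgebraicGeometry.Resolution.FormalBranchDescent
import Summits.ResolutionOfSingularities.ResolutionOfSingularities.Theorems.RadicialJungCleanModelsStubRegularTypeDescends
import Summits.ResolutionOfSingularities.ResolutionOfSingularities.Theorems.RadicialJungCleanModelsStubExtendParameter
import HarnessLib

/-!
# Stub `stub_cleanOrNodalOfFormal` for crux stmt-ResolutionOfSingularities-15917
(`RadicialJung.CleanModels`, line `Sketch` rev 7)

**Formally clean ⇒ Zariski clean or NODAL, in dimension `≤ 2`.** Let `O` be a regular local
domain of prime characteristic `p` and dimension `≤ 2` with completion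
`ι : O → Ô = AdicCompletion (maximalIdeal O) O`, `𝔪̂ = 𝔪 Ô`, whose prime elements `f` are
ANALYTICALLY UNRAMIFIED (`Ô / f Ô` reduced), `K` an `O`-algebra and `x ∈ K` formally loosely
clean: `x = s` with `ι s = û ∏_{i<m} τ_i^{a_i}` for a minimal generating system `(τ_i)_{i<d}` of
`𝔪̂` (`d = dim O`, `1 ≤ m ≤ d`, `û ∈ Ô^×`, `p ∤ a_i`), or of formal regular type (i)/(ii). Then
`x` is Zariski loosely clean, or of NODAL type: `x = u f^e`, `u ∈ O^×`, `p ∤ e`,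
`f ≡ c t₁ t₂ (mod 𝔪³)` for a regular system of parameters `(t₁, t₂)` and a unit `c`.

## Proof (`toroidal_descent`; lemmas in `Literature/…/Resolution/FormalBranchDescent.lean`)

Formal regular types descend by `stub_regularTypeDescends`. In the toroidal case `Ô` is a
regular local ring, hence a domain and a UFD, the `τ_i` are pairwise non-associated prime
elements of `Ô` outside `𝔪̂²`, and `O` is a UFD with `O → Ô` faithfully flat and local.

* `m = 1`: `s = u f^{a₀}` with `ι f ~ τ₀ ∉ 𝔪̂²` (`descent_one_branch`: a prime factor `f` of
  `s` has `ι f ~ τ₀^b`, and `b = 1` by analytic unramifiedness), so `f ∈ 𝔪 ∖ 𝔪²` extends to a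
  regular system of parameters (`stub_extendParameter`) — Zariski toroidal.
* `m = 2 = d`: a prime factor `f` of `s` has `ι f ~ τ₀^{b₀} τ₁^{b₁}` with `b_i ≤ 1`
  (`le_one_of_associated_pow_mul`).
  If `ι f ~ τ₀` (or `τ₁`): peel `f^{a₀}` off and apply the one-branch descent to the rest
  (`descent_two_branch`): `s = u f^{a₀} f'^{a₁}` with `(ι f, ι f') = (τ₀, τ₁) = 𝔪̂`, so
  `(f, f') = 𝔪` by faithful flatness (`span_pair_eq_maximalIdeal`) — Zariski toroidal.
  If `ι f ~ τ₀ τ₁` (`descent_double_branch`): `s = s' f^{min}`, and `ι s'` is a unit times a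
  power of one `τ_i`; a positive power would produce a prime `f' ∣ f` with `ι f' ~ τ_i`, forcing
  `τ_{1-i}` to be a unit; so `a₀ = a₁ = e`, `s = u f^e`, and adapted parameters
  `ι t_j ≡ τ_j (mod 𝔪̂²)` (`exists_coord_adapted`) with `ι c ≡ w (mod 𝔪̂)` give
  `f - c t₀ t₁ ∈ 𝔪̂³ ∩ O = 𝔪³` (`nodal_congruence`) — NODAL.
-/

noncomputable section

set_option linter.dupNamespace false

open IsLocalRing Literature.AlgebraicGeometry.Resolution

namespace Summit.ResolutionOfSingularities.ResolutionOfSingularities.Theorems.RadicialJung.CleanModels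

universe u

/-- **The toroidal descent in dimension `≤ 2`** (the heart of `stub_cleanOrNodalOfFormal`): if
`ι s = û ∏_{i<m} τ_i^{a_i}` for a minimal generating system `(τ_i)_{i<d}` of `𝔪̂ = 𝔪 Ô`
(`d = dim O ≤ 2`, `1 ≤ m ≤ d`, `û` unit, `p ∤ a_i`) and the primes of `O` are analytically
unramified, then `s = u ∏_{i<m} t_i^{a_i}` for a regular system of parameters `(t_i)` of `O` and a
unit `u`, or `s` is of nodal type. -/
theorem toroidal_descent {O : Type u} [CommRing O] [IsRegularLocalRing O] [IsDomain O] (p : ℕ)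
    (hd2 : ringKrullDim O ≤ 2)
    (hexc : ∀ f₁ : O, Prime f₁ → IsReduced (AdicCompletion (maximalIdeal O) O ⧸
      Ideal.span {algebraMap O (AdicCompletion (maximalIdeal O) O) f₁}))
    {d m : ℕ} (hmd : m ≤ d) (τ : Fin d → AdicCompletion (maximalIdeal O) O) (a : Fin m → ℕ)
    (û : AdicCompletion (maximalIdeal O) O) (s : O) (hû : IsUnit û)
    (hτ : Ideal.span (Set.range τ) =
      (maximalIdeal O).map (algebraMap O (AdicCompletion (maximalIdeal O) O)))
    (hd : ringKrullDim O = (d : WithBot ℕ∞)) (hm : 0 < m) (ha : ∀ i, ¬ p ∣ a i)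
    (hs : algebraMap O (AdicCompletion (maximalIdeal O) O) s =
      û * ∏ i : Fin m, τ (Fin.castLE hmd i) ^ (a i)) :
    (∃ (d m : ℕ) (hmd : m ≤ d) (t : Fin d → O) (a : Fin m → ℕ) (u : O), IsUnit u ∧
        Ideal.span (Set.range t) = maximalIdeal O ∧ ringKrullDim O = (d : WithBot ℕ∞) ∧ 0 < m ∧
        (∀ i, ¬ p ∣ a i) ∧ s = u * ∏ i : Fin m, t (Fin.castLE hmd i) ^ (a i)) ∨
      (∃ (u f₁ c t₁ t₂ : O) (e : ℕ), IsUnit u ∧ IsUnit c ∧ ¬ p ∣ e ∧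
        Ideal.span {t₁, t₂} = maximalIdeal O ∧ ringKrullDim O = (2 : WithBot ℕ∞) ∧
        s = u * f₁ ^ e ∧ f₁ - c * t₁ * t₂ ∈ maximalIdeal O ^ 3) := by
  haveI hreg := isRegularLocalRing_adicCompletion O
  haveI : IsDomain (AdicCompletion (maximalIdeal O) O) := isDomain_of_isRegularLocalRing _
  haveI : UniqueFactorizationMonoid (AdicCompletion (maximalIdeal O) O) :=
    uniqueFactorizationMonoid_of_isRegularLocalRing _ hreg
  have hdle : d ≤ 2 := by
    have h : (d : WithBot ℕ∞) ≤ 2 := hd ▸ hd2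
    exact_mod_cast h
  have hτ' : Ideal.span (Set.range τ) = maximalIdeal (AdicCompletion (maximalIdeal O) O) := by
    rw [hτ, AdicCompletion.maximalIdeal_eq_map]
  have hdc : ringKrullDim (AdicCompletion (maximalIdeal O) O) = (d : WithBot ℕ∞) := by
    rw [ringKrullDim_adicCompletion, hd]
  have hprime : ∀ j, Prime (τ j) := prime_of_rsop τ hτ' hdc
  have ha0 : ∀ i, a i ≠ 0 := fun i h => ha i (h ▸ dvd_zero p)
  obtain rfl | rfl : m = 1 ∨ m = 2 := by omega
  · -- one formal branch: `ι s = û τ_j ^ (a 0)`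
    rw [Fin.prod_univ_one] at hs
    obtain ⟨f, u, w, hf, hu, hw, hfw, rfl⟩ := descent_one_branch hexc (hprime _) hû (ha0 0) hs
    have hfm : f ∈ maximalIdeal O := (mem_maximalIdeal f).mpr (mem_nonunits_iff.mpr hf.not_unit)
    have hfm2 : f ∉ maximalIdeal O ^ 2 := by
      intro h
      have h' : algebraMap O (AdicCompletion (maximalIdeal O) O) f ∈
          maximalIdeal (AdicCompletion (maximalIdeal O) O) ^ 2 := by
        rw [AdicCompletion.maximalIdeal_eq_map, ← Ideal.map_pow]
        exact Ideal.mem_map_of_mem _ h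
      rw [hfw, Ideal.unit_mul_mem_iff_mem _ hw] at h'
      exact not_mem_sq_of_rsop τ hτ' hdc _ h'
    obtain ⟨d', hd0, t, ht, hd', htf⟩ := stub_extendParameter f hfm hfm2
    refine Or.inl ⟨d', 1, hd0, t, a, u, hu, ht, hd', one_pos, ha, ?_⟩
    rw [Fin.prod_univ_one]
    have h0 : t (Fin.castLE hd0 0) = f := htf
    rw [h0]
  · -- two formal branches, `d = 2`
    obtain rfl : d = 2 := le_antisymm hdle hmd
    have hd2eq : ringKrullDim O = (2 : WithBot ℕ∞) := by rw [hd]; norm_cast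
    have hc : ∀ (h : 2 ≤ 2) (i : Fin 2), Fin.castLE h i = i := fun h i => Fin.ext rfl
    simp only [hc, Fin.prod_univ_two] at hs
    have h01 : ¬ τ 0 ∣ τ 1 := not_dvd_of_rsop τ hτ' hdc (by decide)
    have h10 : ¬ τ 1 ∣ τ 0 := not_dvd_of_rsop τ hτ' hdc (by decide)
    -- a prime factor `f` of `s`: `ι f ~ τ 0 ^ b₀ * τ 1 ^ b₁` with `b₀, b₁ ≤ 1`
    obtain ⟨f, hf, hfs⟩ := exists_prime_dvd_of_algebraMap_eq
      (mul_ne_zero hû.ne_zero (mul_ne_zero (pow_ne_zero _ (hprime 0).ne_zero)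
        (pow_ne_zero _ (hprime 1).ne_zero)))
      (fun h => (hprime 0).not_unit ((isUnit_pow_iff (ha0 0)).mp
        (isUnit_of_mul_isUnit_left (isUnit_of_mul_isUnit_right h)))) hs
    have hfd : algebraMap O (AdicCompletion (maximalIdeal O) O) f ∣ τ 0 ^ a 0 * τ 1 ^ a 1 :=
      (hû.dvd_mul_left).mp (hs ▸ map_dvd (algebraMap O _) hfs)
    obtain ⟨g₀, g₁, hg₀, hg₁, hfg⟩ := exists_dvd_and_dvd_of_dvd_mul hfd
    obtain ⟨b₀, -, hb₀⟩ := (dvd_prime_pow (hprime 0) _).mp hg₀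
    obtain ⟨b₁, -, hb₁⟩ := (dvd_prime_pow (hprime 1) _).mp hg₁
    have hfa : Associated (algebraMap O (AdicCompletion (maximalIdeal O) O) f)
        (τ 0 ^ b₀ * τ 1 ^ b₁) := hfg ▸ hb₀.mul_mul hb₁
    have hb₀1 : b₀ ≤ 1 := le_one_of_associated_pow_mul (hexc f hf) hfa (hprime 0).ne_zero
      (fun h => h01 ((hprime 0).dvd_of_dvd_pow h))
    have hb₁1 : b₁ ≤ 1 := le_one_of_associated_pow_mul (hexc f hf)
      (hfa.trans (by rw [mul_comm])) (hprime 1).ne_zero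
      (fun h => h10 ((hprime 1).dvd_of_dvd_pow h))
    interval_cases b₀ <;> interval_cases b₁
    · -- `ι f` a unit: impossible
      exfalso
      rw [pow_zero, pow_zero, mul_one] at hfa
      exact hf.not_unit ((isUnit_map_iff (algebraMap O _) f).mp
        (associated_one_iff_isUnit.mp hfa))
    · -- `ι f ~ τ 1`: toroidal with `t = (f', f)`
      rw [pow_zero, pow_one, one_mul] at hfa
      obtain ⟨v, hv⟩ := hfa
      have hfv : algebraMap O (AdicCompletion (maximalIdeal O) O) f = ↑v⁻¹ * τ 1 := by
        rw [← hv, mul_comm (algebraMap O _ f), Units.inv_mul_cancel_left]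
      have hs' : algebraMap O (AdicCompletion (maximalIdeal O) O) s =
          û * (τ 1 ^ a 1 * τ 0 ^ a 0) := by
        rw [hs, mul_comm (τ 0 ^ a 0)]
      obtain ⟨f', u, w', -, hu, hw', hf'w, hsu⟩ :=
        descent_two_branch hexc (hprime 0) hû (Units.isUnit _) hf.ne_zero (ha0 0) hs' hfv
      refine Or.inl ⟨2, 2, le_rfl, ![f', f], a, u, hu, ?_, hd, two_pos, ha, ?_⟩
      · rw [ideal_span_range_fin_two]
        exact span_pair_eq_maximalIdeal hτ hw' (Units.isUnit _) hf'w hfv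
      · rw [hsu]
        simp only [hc, Fin.prod_univ_two, Matrix.cons_val_zero, Matrix.cons_val_one]
        ring
    · -- `ι f ~ τ 0`: toroidal with `t = (f, f')`
      rw [pow_zero, pow_one, mul_one] at hfa
      obtain ⟨v, hv⟩ := hfa
      have hfv : algebraMap O (AdicCompletion (maximalIdeal O) O) f = ↑v⁻¹ * τ 0 := by
        rw [← hv, mul_comm (algebraMap O _ f), Units.inv_mul_cancel_left]
      obtain ⟨f', u, w', -, hu, hw', hf'w, hsu⟩ :=
        descent_two_branch hexc (hprime 1) hû (Units.isUnit _) hf.ne_zero (ha0 1) hs hfv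
      refine Or.inl ⟨2, 2, le_rfl, ![f, f'], a, u, hu, ?_, hd, two_pos, ha, ?_⟩
      · rw [ideal_span_range_fin_two]
        exact span_pair_eq_maximalIdeal hτ (Units.isUnit _) hw' hfv hf'w
      · rw [hsu]
        simp only [hc, Fin.prod_univ_two, Matrix.cons_val_zero, Matrix.cons_val_one]
    · -- `ι f ~ τ 0 * τ 1`: nodal
      rw [pow_one, pow_one] at hfa
      obtain ⟨v, hv⟩ := hfa
      have hfv : algebraMap O (AdicCompletion (maximalIdeal O) O) f = ↑v⁻¹ * (τ 0 * τ 1) := by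
        rw [← hv, mul_comm (algebraMap O _ f), Units.inv_mul_cancel_left]
      obtain ⟨c, t₁, t₂, hcu, ht, hcong⟩ := nodal_congruence hτ' (Units.isUnit _) hfv
      rcases le_total (a 0) (a 1) with hle | hle
      · obtain ⟨-, u, hu, hsu⟩ :=
          descent_double_branch hexc (hprime 0) (hprime 1) hû (Units.isUnit _) hf hle hs hfv
        exact Or.inr ⟨u, f, c, t₁, t₂, a 0, hu, hcu, ha 0, ht, hd2eq, hsu, hcong⟩
      · have hs' : algebraMap O (AdicCompletion (maximalIdeal O) O) s =
            û * (τ 1 ^ a 1 * τ 0 ^ a 0) := by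
          rw [hs, mul_comm (τ 0 ^ a 0)]
        have hfv' : algebraMap O (AdicCompletion (maximalIdeal O) O) f =
            ↑v⁻¹ * (τ 1 * τ 0) := by
          rw [hfv, mul_comm (τ 0)]
        obtain ⟨-, u, hu, hsu⟩ :=
          descent_double_branch hexc (hprime 1) (hprime 0) hû (Units.isUnit _) hf hle hs' hfv'
        exact Or.inr ⟨u, f, c, t₁, t₂, a 1, hu, hcu, ha 1, ht, hd2eq, hsu, hcong⟩

/-- STUB (worker; dim-2 descent, local algebra) — **formally clean ⇒ Zariski clean or NODAL, in
dimension `≤ 2`.** Let `O` be a regular local domain of prime characteristic `p` and dimension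
`≤ 2` whose height-one primes are ANALYTICALLY UNRAMIFIED (`Ô/fÔ` reduced for every prime element
`f`; true for the local rings of a variety), `K` an `O`-algebra and `x ∈ K` formally loosely clean
(`x = s`, `ι s = û ∏_{i<m} τ_i^{a_i}` for a minimal generating system `(τ_i)` of `𝔪̂ = 𝔪Ô`, or of
formal regular type). Then `x` is (Zariski) loosely clean, OR of NODAL TYPE: `x = u f^e` with `u` a
unit, `p ∤ e`, and `f ≡ c t₁ t₂ (mod 𝔪³)` for a regular system of parameters `(t₁, t₂)` of `O` and a
unit `c` (one algebraic branch with two formal branches). Proof: `O` is a UFD; every prime factor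
of `s` is formally a monomial in the `τ_i` times a unit, two distinct prime factors cannot share a
`τ_i` (they generate an `𝔪`-primary ideal), and exponents of `τ_i` in a prime factor are `≤ 1` by
analytic unramifiedness; so either each `τ_i` is (up to `𝔪̂²` and a formal unit) an algebraic prime
factor — Zariski toroidal, units descend by faithful flatness — or `m = 2` and ONE prime factor
`f = w τ₁ τ₂`; adapted parameters `t_j ≡ τ_j (mod 𝔪̂²)` (`exists_coord_adapted`) give
`f ≡ c t₁ t₂ (mod 𝔪³)`. Formal regular types descend (`stub_regularTypeDescends`). -/
theorem stub_cleanOrNodalOfFormal {O K : Type u} [CommRing O] [IsRegularLocalRing O] [IsDomain O]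
    [CommRing K] [Algebra O K] (p : ℕ) (hp : p.Prime) [CharP O p] (hd2 : ringKrullDim O ≤ 2)
    (hexc : ∀ f₁ : O, Prime f₁ →
      IsReduced (AdicCompletion (maximalIdeal (O)) (O) ⧸
        Ideal.span {algebraMap O (AdicCompletion (maximalIdeal (O)) (O)) f₁}))
    (x : K)
    (hx : ((∃ (d m : ℕ) (hmd : m ≤ d) (τ : Fin d → AdicCompletion (maximalIdeal (O)) (O))
            (a : Fin m → ℕ) (û : AdicCompletion (maximalIdeal (O)) (O)) (s : O), IsUnit û ∧
            Ideal.span (Set.range τ) = (maximalIdeal (O)).map (algebraMap (O) (AdicCompletion (maximalIdeal (O)) (O))) ∧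
            ringKrullDim (O) = (d : WithBot ℕ∞) ∧ 0 < m ∧ (∀ i, ¬ p ∣ a i) ∧
            x = algebraMap (O) K s ∧
            algebraMap (O) (AdicCompletion (maximalIdeal (O)) (O)) s = û * ∏ i : Fin m, τ (Fin.castLE hmd i) ^ (a i)) ∨
          (∃ u : O, IsUnit u ∧ x = algebraMap (O) K u ∧
            ∀ ĉ : AdicCompletion (maximalIdeal (O)) (O),
              algebraMap (O) (AdicCompletion (maximalIdeal (O)) (O)) u - ĉ ^ p ∉ (maximalIdeal (O)).map (algebraMap (O) (AdicCompletion (maximalIdeal (O)) (O)))) ∨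
          (∃ (s : O) (ĉ : AdicCompletion (maximalIdeal (O)) (O)), x = algebraMap (O) K s ∧
            algebraMap (O) (AdicCompletion (maximalIdeal (O)) (O)) s - ĉ ^ p ∈ (maximalIdeal (O)).map (algebraMap (O) (AdicCompletion (maximalIdeal (O)) (O))) ∧
            algebraMap (O) (AdicCompletion (maximalIdeal (O)) (O)) s - ĉ ^ p ∉ (maximalIdeal (O)).map (algebraMap (O) (AdicCompletion (maximalIdeal (O)) (O))) ^ 2))) :
    ((∃ (d m : ℕ) (hmd : m ≤ d) (t : Fin d → O) (a : Fin m → ℕ)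
            (u : O), IsUnit u ∧
            Ideal.span (Set.range t) = maximalIdeal (O) ∧
            ringKrullDim (O) = (d : WithBot ℕ∞) ∧ 0 < m ∧ (∀ i, ¬ p ∣ a i) ∧
            x =
              algebraMap (O) K (u * ∏ i : Fin m, t (Fin.castLE hmd i) ^ (a i))) ∨
          (∃ u : O, IsUnit u ∧ x = algebraMap (O) K u ∧
            ∀ c' : O, u - c' ^ p ∉ maximalIdeal (O)) ∨
          (∃ s c' : O, x = algebraMap (O) K s ∧
            s - c' ^ p ∈ maximalIdeal (O) ∧ s - c' ^ p ∉ maximalIdeal (O) ^ 2)) ∨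
      (∃ (u f₁ c t₁ t₂ : O) (e : ℕ), IsUnit u ∧ IsUnit c ∧ ¬ p ∣ e ∧
            Ideal.span {t₁, t₂} = maximalIdeal (O) ∧ ringKrullDim (O) = (2 : WithBot ℕ∞) ∧
            x = algebraMap (O) K (u * f₁ ^ e) ∧
            f₁ - c * t₁ * t₂ ∈ maximalIdeal (O) ^ 3) := by
  rcases hx with ⟨d, m, hmd, τ, a, û, s, hû, hτ, hd, hm, ha, hx, hs⟩ | ⟨u, hu, hx, hc⟩ |
    ⟨s, ĉ, hx, h1, h2⟩
  · rcases toroidal_descent p hd2 hexc hmd τ a û s hû hτ hd hm ha hs with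
      ⟨d', m', hmd', t, a', u, hu, ht, hd', hm', ha', hs'⟩ |
      ⟨u, f₁, c, t₁, t₂, e, hu, hc, he, ht, hd', hs', hf⟩
    · exact Or.inl (Or.inl ⟨d', m', hmd', t, a', u, hu, ht, hd', hm', ha', by rw [hx, hs']⟩)
    · exact Or.inr ⟨u, f₁, c, t₁, t₂, e, hu, hc, he, ht, hd', by rw [hx, hs'], hf⟩
  · exact Or.inl (Or.inr (Or.inl ⟨u, hu, hx, (stub_regularTypeDescends p hp).1 u hc⟩))
  · obtain ⟨c, hc1, hc2⟩ := (stub_regularTypeDescends p hp).2 s ⟨ĉ, h1, h2⟩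
    exact Or.inl (Or.inr (Or.inr ⟨s, c, hx, hc1, hc2⟩))

end Summit.ResolutionOfSingularities.ResolutionOfSingularities.Theorems.RadicialJung.CleanModels

end
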